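import Mathlib
import HarnessLib

/-!
# A quantitative `h¹ = 0`: Hodge-type decomposition constant for a finite-dimensional exact complex
# (route-independent helper toward the crux `TwistExponentGap.RigidTwistCeiling` ⟨stmt-QuantumFields-24054⟩, step (W3); free hands
# of width seat ym-line-sfw-p2-w3)

For linear maps `d₀ : C₀ → C₁`, `d₁ : C₁ → C₂` between finite-dimensional real inner product spaces with `d₁ ∘ d₀ = 0` and
`ker d₁ ⊆ range d₀` (`h¹ = 0`, e.g. `twistedFlat_cocycle_exact`), there is ONE constant `K > 0` such that every `X ∈ C₁` splits as
`X = d₀ η + (X − d₀ η)` orthogonally with `‖X − d₀ η‖ ≤ K ‖d₁ X‖` (`exists_hodge_constant`): `d₀ η` is the orthogonal projection of `X`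
onto `range d₀` and `d₁` is injective, hence bounded below, on `(range d₀)ᗮ`.  This is the form in which infinitesimal rigidity
enters the local Morse–Bott inequality of ⟨24054⟩ (gauge part `d₀η` handled by the gauge minimisation, transversal part by `d₁`).
HONEST FRAMING: finite-dimensional linear algebra; nothing here bears on a summit statement or on the Yang–Mills mass gap.
-/

set_option autoImplicit false

open scoped RealInnerProductSpace

namespace Summit.QuantumFields.YangMills.Theorems.TwistExponentGap

/-- **Hodge constant.**  `d₁ ∘ d₀ = 0` and `ker d₁ ⊆ range d₀` on finite-dimensional real inner product spaces give `K > 0` with: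
for every `X` there is `η` such that `‖X − d₀η‖ ≤ K‖d₁X‖`, `⟪X, d₀η⟫ = ‖d₀η‖²` and `‖X‖² = ‖d₀η‖² + ‖X − d₀η‖²`. -/
theorem exists_hodge_constant {C₀ C₁ C₂ : Type*} [NormedAddCommGroup C₀] [InnerProductSpace ℝ C₀]
    [NormedAddCommGroup C₁] [InnerProductSpace ℝ C₁] [FiniteDimensional ℝ C₁]
    [NormedAddCommGroup C₂] [InnerProductSpace ℝ C₂]
    (d₀ : C₀ →ₗ[ℝ] C₁) (d₁ : C₁ →ₗ[ℝ] C₂) (hdd : ∀ η, d₁ (d₀ η) = 0)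
    (hexact : ∀ X, d₁ X = 0 → X ∈ LinearMap.range d₀) :
    ∃ K : ℝ, 0 < K ∧ ∀ X : C₁, ∃ η : C₀,
      ‖X - d₀ η‖ ≤ K * ‖d₁ X‖ ∧ ⟪X, d₀ η⟫ = ‖d₀ η‖ ^ 2 ∧ ‖X‖ ^ 2 = ‖d₀ η‖ ^ 2 + ‖X - d₀ η‖ ^ 2 := by
  classical
  set R : Submodule ℝ C₁ := LinearMap.range d₀ with hR
  haveI : CompleteSpace R := FiniteDimensional.complete ℝ R
  haveI : R.HasOrthogonalProjection := inferInstance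
  -- `d₁` is injective on `Rᗮ`
  set f : Rᗮ →ₗ[ℝ] C₂ := d₁.domRestrict Rᗮ with hf
  have hfinj : Function.Injective f := by
    rw [← LinearMap.ker_eq_bot, LinearMap.ker_eq_bot']
    intro v hv
    have hv1 : (v : C₁) ∈ R := hexact v hv
    have hv2 : (v : C₁) ∈ Rᗮ := v.2
    have h0 : (v : C₁) = 0 := by
      have := Submodule.inner_right_of_mem_orthogonal hv1 hv2
      exact inner_self_eq_zero.1 this
    exact Subtype.ext h0
  obtain ⟨K, hKpos, hK⟩ := (LinearMap.injective_iff_antilipschitz f).1 hfinj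
  refine ⟨K, by exact_mod_cast hKpos, fun X => ?_⟩
  -- the projection of `X` onto `range d₀`
  have hY : R.starProjection X ∈ R := R.starProjection_apply_mem X
  obtain ⟨η, hη⟩ := LinearMap.mem_range.1 hY
  have hperp : X - d₀ η ∈ Rᗮ := by rw [hη]; exact R.sub_starProjection_mem_orthogonal X
  refine ⟨η, ?_, ?_, ?_⟩
  · -- transversal part bounded by `d₁`
    have h1 := hK.le_mul_dist ⟨X - d₀ η, hperp⟩ 0
    simp only [dist_zero_right, map_zero] at h1
    have h2 : f ⟨X - d₀ η, hperp⟩ = d₁ X := by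
      simp only [hf, LinearMap.domRestrict_apply, map_sub, hdd, sub_zero]
    rw [h2] at h1
    simpa using h1
  · have h := R.starProjection_inner_eq_zero X (d₀ η) (LinearMap.mem_range_self d₀ η)
    rw [← hη] at h
    rw [inner_sub_left, sub_eq_zero] at h
    rw [h, real_inner_self_eq_norm_sq]
  · have horth : ⟪d₀ η, X - d₀ η⟫ = 0 := by
      have h := R.starProjection_inner_eq_zero X (d₀ η) (LinearMap.mem_range_self d₀ η)
      rw [← hη] at h
      rw [real_inner_comm]; exact h
    have h := norm_add_sq_eq_norm_sq_add_norm_sq_of_inner_eq_zero (d₀ η) (X - d₀ η) horth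
    rw [add_sub_cancel] at h
    nlinarith [h]

end Summit.QuantumFields.YangMills.Theorems.TwistExponentGap
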